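import Summits.ResolutionOfSingularities.ResolutionOfSingularities.Theorems.FrobeniusLadderFRationalResolutionFanStepAvoidsRegular
import Literature.Geometry.PolyhedralFans.StrictSupport
import HarnessLib

/-!
# Crux `FrobeniusLadder.FRationalResolution` (stmt-ResolutionOfSingularities-15317), line `redirect`,
# stub `stub_diagonalizableQuotientResolution` — the support function of a regularisation VANISHES ON THE SPARED CONES
# (second half of the fan brick (α′) of the repair census)

[KKMS] I §2 Thm. 11 builds a strictly convex support function along a sequence of star subdivisions (`f ↦ M f + starCoord_v`,
tree: `Fan.SupportData.starSubdivision`, `ProjectiveSubdivision.lean`), then tightens, shifts and clears denominators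
(`Fan.exists_isStrictSupport_starIter`, `StrictSupport.lean`). The shift (`Fan.exists_add_nonneg_on`) is unnecessary when one
starts from `f = 0` and only adds star coordinates (`f ≥ 0` throughout), and without it the value function VANISHES on every
cone of the original fan that contains none of the star points (`starCoord_v = 0` off the star of `v`). Combined with
`Fan.exists_regular_starIter_avoiding` (`…FanStepAvoidsRegular`): **a primitively simplicial face fan of a cone `σ` has a
regular refinement by star subdivisions with tight integral strict support data `m ≥ 0` on `σ` whose value function vanishes
on every REGULAR face of `σ` (each of which survives), and is positive somewhere as soon as one subdivision happened.** This is
the fan input of `…PrimaryCentreAtIsolatedPoint.exists_primary_monomialCentre_of_isolated` (up to translating «regular face»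
into «orthant-like localisation», brick (ι′)).

* `Fan.SupportData.exists_starIter_vanishing` — support data along `starIter l` with `f ≥ 0`, `f = 0` on the cones avoided by
  `l`, and `f > 0` at the first star point;
* **`Fan.exists_regular_refinement_isStrictSupport_sparing`** — the statement above.

Honest label: fan combinatorics (no stub closed). No definitions, no named facts, no sorry.
[cite: KempfEtAl1973, Ch. I §2 Thm. 11] [cite: Fulton1993Toric, §2.6 p. 48]
-/

-- single-problem summit: the doubled namespace component is forced
set_option linter.dupNamespace false

namespace Literature.Geometry.PolyhedralFans

open PointedCone Finset

variable {κ : Type*} [Fintype κ]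


namespace Fan

/-- `Fan.exists_regular_starIter_avoiding` with the star points recorded IN THE SUPPORT (each step's point lies in the
support of the current fan, which is the support of the original one). [cite: Ewald1996, VI Thm. 8.5] -/
theorem exists_regular_starIter_avoiding_mem_support [DecidableEq κ] {Δ : Fan ℚ (κ → ℚ)} (hΔ : Δ.IsPrimSimplicial) :
    ∃ l : List (κ → ℚ), (∀ w ∈ l, w ∈ latticeN κ ∧ w ≠ 0 ∧ w ∈ Δ.support) ∧
      (Δ.starIter l).Refines Δ ∧ (Δ.starIter l).IsRegular ∧
      ∀ τ ∈ Δ.cones, ∀ T : Finset (κ → ℚ), IsPrimGens τ T → IsRegularGens T →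
        τ ∈ (Δ.starIter l).cones ∧ ∀ w ∈ l, w ∉ τ := by
  suffices h : ∀ M N : ℕ, ∀ Δ : Fan ℚ (κ → ℚ), Δ.IsPrimSimplicial → Δ.maxPMult = M →
      Δ.numMax = N → ∃ l : List (κ → ℚ), (∀ w ∈ l, w ∈ latticeN κ ∧ w ≠ 0 ∧ w ∈ Δ.support) ∧
        (Δ.starIter l).Refines Δ ∧ (Δ.starIter l).IsRegular ∧
        ∀ τ ∈ Δ.cones, ∀ T : Finset (κ → ℚ), IsPrimGens τ T → IsRegularGens T →
          τ ∈ (Δ.starIter l).cones ∧ ∀ w ∈ l, w ∉ τ from h _ _ Δ hΔ rfl rfl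
  intro M
  induction M using Nat.strong_induction_on with
  | _ M ihM =>
    intro N
    induction N using Nat.strong_induction_on with
    | _ N ihN =>
      intro Δ hΔ hM hN
      by_cases hreg : Δ.IsRegular
      · exact ⟨[], fun _ h => absurd h List.not_mem_nil, Refines.refl Δ, hreg,
          fun τ hτ _ _ _ => ⟨hτ, fun _ h => absurd h List.not_mem_nil⟩⟩
      · obtain ⟨w, hwN, hwsupp, hw0, hΔ', hlex, havoid⟩ := exists_step_avoiding hΔ hreg
        have hstep : (Δ.starSubdivision w).Refines Δ := (starSubdivision_refines hwsupp hw0).1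
        obtain ⟨l, hl, href, hreg', hkeep⟩ : ∃ l : List (κ → ℚ),
            (∀ w' ∈ l, w' ∈ latticeN κ ∧ w' ≠ 0 ∧ w' ∈ (Δ.starSubdivision w).support) ∧
            ((Δ.starSubdivision w).starIter l).Refines (Δ.starSubdivision w) ∧
            ((Δ.starSubdivision w).starIter l).IsRegular ∧
            ∀ τ ∈ (Δ.starSubdivision w).cones, ∀ T : Finset (κ → ℚ), IsPrimGens τ T → IsRegularGens T →
              τ ∈ ((Δ.starSubdivision w).starIter l).cones ∧ ∀ w ∈ l, w ∉ τ := by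
          rcases hlex with h1 | ⟨h1, h2⟩
          · exact ihM _ (hM ▸ h1) _ _ hΔ' rfl rfl
          · exact ihN _ (hN ▸ h2) _ hΔ' (h1.trans hM) rfl
        refine ⟨w :: l, fun v hv => ?_, ?_, ?_, fun τ hτ T hT hTreg => ?_⟩
        · rcases List.mem_cons.mp hv with rfl | hv
          · exact ⟨hwN, hw0, hwsupp⟩
          · obtain ⟨h1, h2, h3⟩ := hl v hv
            exact ⟨h1, h2, hstep.support_eq ▸ h3⟩
        · rw [starIter_cons]; exact href.trans hstep
        · rw [starIter_cons]; exact hreg'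
        · have hwτ : w ∉ τ := havoid τ hτ T hT hTreg
          have hτ' : τ ∈ (Δ.starSubdivision w).cones := by
            rw [starSubdivision_cones]; exact mem_starCones_of_not_mem hτ hwτ
          obtain ⟨hτl, hlτ⟩ := hkeep τ hτ' T hT hTreg
          refine ⟨by rw [starIter_cons]; exact hτl, fun v hv => ?_⟩
          rcases List.mem_cons.mp hv with rfl | hv
          · exact hwτ
          · exact hlτ v hv

end Fan

namespace Fan.SupportData

/-- **Support data along an iterated star subdivision, with values tracked**: starting from data `D` with `f ≥ 0`, after
starring through the non-zero vectors of `l` there are support data with `f' ≥ 0`, `f' = 0` on every cone of the original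
fan avoided by all the star points and on which `f = 0`, and — if the first star point lies in the support — `f' > 0` there.
[cite: KempfEtAl1973, Ch. I §2 Thm. 11 proof, Lemma 2] -/
theorem exists_starIter_vanishing [DecidableEq κ] :
    ∀ (l : List (κ → ℚ)) {Δ : Fan ℚ (κ → ℚ)} (D : Δ.SupportData), (∀ w ∈ l, w ≠ 0) → (∀ x, 0 ≤ D.f x) →
      ∃ D' : (Δ.starIter l).SupportData, (∀ x, 0 ≤ D'.f x) ∧
        (∀ τ ∈ Δ.cones, (∀ w ∈ l, w ∉ τ) → (∀ x ∈ τ, D.f x = 0) →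
          τ ∈ (Δ.starIter l).cones ∧ ∀ x ∈ τ, D'.f x = 0) ∧
        (∀ x, 0 < D.f x → 0 < D'.f x) ∧
        (∀ w ∈ l.head?, w ∈ Δ.support → 0 < D'.f w)
  | [], Δ, D, _, hnn => ⟨D, hnn, fun τ hτ _ hf => ⟨hτ, hf⟩, fun _ h => h, fun w hw => by simp at hw⟩
  | u :: l, Δ, D, hl0, hnn => by
    have hu0 : u ≠ 0 := hl0 u (by simp)
    have hl0' : ∀ w ∈ l, w ≠ 0 := fun w hw => hl0 w (by simp [hw])
    rw [Fan.starIter_cons]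
    by_cases hu : u ∈ Δ.support
    · -- star through `u`: `f₁ = M f + starCoord_u`
      set D₁ := D.starSubdivision hu hu0 with hD₁
      have hf₁ : ∀ x, D₁.f x = D.bigM u * D.f x + Δ.starCoord u x := fun x => rfl
      have hM := D.bigM_pos (v := u)
      have hnn₁ : ∀ x, 0 ≤ D₁.f x := fun x => by
        rw [hf₁]; exact add_nonneg (mul_nonneg hM.le (hnn x)) (starCoord_nonneg _ _)
      obtain ⟨D', hnn', hkeep, hposkeep, -⟩ := exists_starIter_vanishing l D₁ hl0' hnn₁
      refine ⟨D', hnn', fun τ hτ hlτ hfτ => ?_, fun x hx => ?_, fun w hw hws => ?_⟩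
      · have huτ : u ∉ τ := hlτ u (by simp)
        have hτ₁ : τ ∈ (Δ.starSubdivision u).cones := by
          rw [Fan.starSubdivision_cones]; exact Fan.mem_starCones_of_not_mem hτ huτ
        have hf₁τ : ∀ x ∈ τ, D₁.f x = 0 := fun x hx => by
          rw [hf₁, hfτ x hx, mul_zero, zero_add, starCoord_of_not_mem hτ huτ hx]
        exact hkeep τ hτ₁ (fun w hw => hlτ w (by simp [hw])) hf₁τ
      · apply hposkeep
        rw [hf₁]
        exact add_pos_of_pos_of_nonneg (mul_pos hM hx) (starCoord_nonneg _ _)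
      · simp only [List.head?_cons, Option.mem_def, Option.some.injEq] at hw
        subst hw
        apply hposkeep
        rw [hf₁]
        obtain ⟨σ, hσ, hwσ⟩ := Fan.mem_support.mp hws
        have h1 : Δ.starCoord u u = 1 := by
          have := starCoord_eq (Δ := Δ) hσ hwσ (Δ.bot_mem hσ) (by rwa [Submodule.mem_bot]) bot_le
            (t := 0) (Submodule.zero_mem _) (c := 1) zero_le_one
          rwa [one_smul, zero_add] at this
        rw [h1]
        exact add_pos_of_nonneg_of_pos (mul_nonneg hM.le (hnn u)) one_pos
    · -- `u` off the support: nothing changes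
      set D₁ : (Δ.starSubdivision u).SupportData := D.copy (Fan.starSubdivision_cones_of_not_mem_support hu) with hD₁
      have hf₁ : ∀ x, D₁.f x = D.f x := fun x => rfl
      obtain ⟨D', hnn', hkeep, hposkeep, -⟩ := exists_starIter_vanishing l D₁ hl0' (fun x => by rw [hf₁]; exact hnn x)
      refine ⟨D', hnn', fun τ hτ hlτ hfτ => ?_, fun x hx => hposkeep x (by rw [hf₁]; exact hx), fun w hw hws => ?_⟩
      · have hτ₁ : τ ∈ (Δ.starSubdivision u).cones := by
          rw [Fan.starSubdivision_cones_of_not_mem_support hu]; exact hτ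
        exact hkeep τ hτ₁ (fun w hw => hlτ w (by simp [hw])) (fun x hx => by rw [hf₁]; exact hfτ x hx)
      · simp only [List.head?_cons, Option.mem_def, Option.some.injEq] at hw
        subst hw
        exact absurd hws hu

end Fan.SupportData

/-- **[KKMS] I §2 Thm. 11 for one cone, SPARING THE REGULAR FACES.** Let `σ ⊆ ℚ^κ` be finitely generated and salient with
primitively simplicial face fan (e.g. `σ` simplicial on primitive generators). Then a sequence of star subdivisions through
non-zero lattice vectors refines the face fan of `σ` to a REGULAR fan `Δ'` carrying tight integral strict support data
`m`, non-negative on `σ`, such that every regular face `τ` of `σ` is a cone of `Δ'` on which the value function vanishes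
(`m ρ ⬝ᵥ x = 0` for `x ∈ τ ∩ ρ`), and the value function is positive somewhere unless no subdivision was needed (`σ` regular
already gives `l = []`; in general: positive at the first star point). [cite: KempfEtAl1973, Ch. I §2 Thm. 11]
[cite: Fulton1993Toric, §2.6 p. 48] -/
theorem Fan.exists_regular_refinement_isStrictSupport_sparing [DecidableEq κ] (σ : PointedCone ℚ (κ → ℚ))
    (hfg : σ.FG) (hsal : IsSalient σ) (hps : (Fan.ofCone σ hfg hsal).IsPrimSimplicial) :
    ∃ l : List (κ → ℚ), (∀ w ∈ l, w ∈ latticeN κ ∧ w ≠ 0) ∧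
      ((Fan.ofCone σ hfg hsal).starIter l).Refines (Fan.ofCone σ hfg hsal) ∧
      ((Fan.ofCone σ hfg hsal).starIter l).IsRegular ∧
      ∃ m : PointedCone ℚ (κ → ℚ) → (κ → ℚ),
        ((Fan.ofCone σ hfg hsal).starIter l).IsStrictSupport m ∧
        (∀ ρ ∈ ((Fan.ofCone σ hfg hsal).starIter l).cones, m ρ ∈ latticeN κ) ∧
        (∀ ρ ∈ ((Fan.ofCone σ hfg hsal).starIter l).cones, ∀ x ∈ σ, 0 ≤ m ρ ⬝ᵥ x) ∧
        (∀ τ ∈ (Fan.ofCone σ hfg hsal).cones, ∀ T : Finset (κ → ℚ), IsPrimGens τ T → IsRegularGens T →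
          τ ∈ ((Fan.ofCone σ hfg hsal).starIter l).cones ∧
          ∀ ρ ∈ ((Fan.ofCone σ hfg hsal).starIter l).cones, ∀ x ∈ ρ, x ∈ τ → m ρ ⬝ᵥ x = 0) ∧
        (l ≠ [] → ∃ ρ ∈ ((Fan.ofCone σ hfg hsal).starIter l).cones, ∃ x ∈ ρ, 0 < m ρ ⬝ᵥ x) := by
  set Δ₀ := Fan.ofCone σ hfg hsal with hΔ₀
  obtain ⟨l, hl, href, hreg, hkeep⟩ := Fan.exists_regular_starIter_avoiding_mem_support hps
  set Δ' := Δ₀.starIter l with hΔ'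
  -- support data with tracked values, from `f = 0`
  obtain ⟨D, hnn, hvan, -, hhead⟩ := Fan.SupportData.exists_starIter_vanishing l
    (Fan.SupportData.ofCone σ hfg hsal) (fun w hw => (hl w hw).2.1) (fun _ => le_rfl)
  -- tighten and clear denominators (no shift: `f ≥ 0` already)
  have h₁ : Δ'.IsStrictSupport D.tightPiece := D.isStrictSupport_tightPiece
  obtain ⟨N, hN, hint⟩ := Fan.exists_nat_smul_integral Δ' D.tightPiece
  have hN' : (0 : ℚ) < N := by exact_mod_cast hN
  have hsupp : Δ'.support = (σ : Set (κ → ℚ)) := by rw [hΔ', href.support_eq, Fan.support_ofCone]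
  -- the value of the tight pieces on their own cone
  have hval : ∀ ρ ∈ Δ'.cones, ∀ x ∈ ρ, D.tightPiece ρ ⬝ᵥ x = D.tightM * D.f x := by
    intro ρ hρ x hx
    exact ((D.tight_local hρ (D.le_domain hρ hx)).2.mpr hx).symm
  have hMpos : 0 < D.tightM := D.tightM_pos
  refine ⟨l, fun w hw => ⟨(hl w hw).1, (hl w hw).2.1⟩, href, hreg, fun ρ => (N : ℚ) • D.tightPiece ρ,
    h₁.smul hN', hint, ?_, ?_, ?_⟩
  · -- non-negative on `σ`
    intro ρ hρ x hx
    have hxs : x ∈ Δ'.support := by rw [hsupp]; exact hx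
    obtain ⟨ρ', hρ', hxρ'⟩ := Fan.mem_support.mp hxs
    rw [smul_dotProduct, smul_eq_mul]
    refine mul_nonneg hN'.le ?_
    calc (0 : ℚ) ≤ D.tightM * D.f x := mul_nonneg hMpos.le (hnn x)
      _ = D.tightPiece ρ' ⬝ᵥ x := (hval ρ' hρ' x hxρ').symm
      _ ≤ D.tightPiece ρ ⬝ᵥ x := (h₁ hρ hρ' hxρ').1
  · -- regular faces survive and carry the value `0`
    intro τ hτ T hT hTreg
    obtain ⟨hτ', hlτ⟩ := hkeep τ hτ T hT hTreg
    obtain ⟨-, hzero⟩ := hvan τ hτ hlτ (fun _ _ => rfl)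
    refine ⟨hτ', fun ρ hρ x hxρ hxτ => ?_⟩
    rw [smul_dotProduct, smul_eq_mul, h₁.eq_of_mem_of_mem hρ hτ' hxρ hxτ, hval τ hτ' x hxτ, hzero x hxτ, mul_zero,
      mul_zero]
  · -- positive at the first star point
    intro hlne
    obtain ⟨w, l', rfl⟩ := List.exists_cons_of_ne_nil hlne
    have hw : w ∈ Δ₀.support := (hl w (by simp)).2.2
    have hfw : 0 < D.f w := hhead w (by simp) hw
    have hws : w ∈ Δ'.support := by rw [hsupp, ← Fan.support_ofCone hfg hsal]; exact hw
    obtain ⟨ρ, hρ, hwρ⟩ := Fan.mem_support.mp hws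
    refine ⟨ρ, hρ, w, hwρ, ?_⟩
    rw [smul_dotProduct, smul_eq_mul, hval ρ hρ w hwρ]
    exact mul_pos hN' (mul_pos hMpos hfw)

end Literature.Geometry.PolyhedralFans
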